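/-
Copyright (c) 2026 the pub-hodgecm-mathlib formalisation cell (harness21).  Prover seat hodgecm-mathlib-K2E1b-p06 (g0),
Track B «K2-LIT» ∕ h413, unit U0 «TwistIntegration» of the line `K2_E1b_GKCohomologyU21`, file #8: payment of the socket
`K2E1bGKCohomologyU21.U0.sig_K2E1bTwistHermitian` — UNITARITY SURVIVES THE CENTRAL TWIST.  2026-09-03.
-/
import Summits.HodgeConjecture.HodgeConjecture.Theorems.K2E1bKTypeTwistDefs      -- ★ defs leaf: `IsTwistOf`
import Summits.HodgeConjecture.HodgeConjecture.Theorems.F0P3bU21Restriction       -- ★ (w3g) `kovLie`, `hasInvariantHermitianForm_kovLie_of_signSkew`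
import Literature.RepresentationTheory.Kovacevic2021.SU21Unitarity                -- ★ `SU21Datum.IsUnitarizable`
import Literature.RepresentationTheory.BorelWallach2000.UpqDeterminantCharacter   -- ★ `upq_trace_re_eq_zero`
import HarnessLib

/-!
# K2_E1b road (h413 = stmt-HodgeConjecture-24833), unit U0 «TwistIntegration», file #8:
# Kovačević's invariant Hermitian form is invariant for the centrally TWISTED `𝔲(2,1)`-action

Cell `pub/hodgecm-mathlib` (D-0151), Track B (21-frontier RULING «PUSH BOTH» 2026-09-03, director req621∕req624,
chair K2-lead ORDER #1 §4.4 ∕ ORDER #2, SKELETON LANDED K2E1b l.72387), socket module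
`Summits/HodgeConjecture/HodgeConjecture/Cruxes/H413/Lines/K2_E1b_GKCohomologyU21_U0_TwistIntegration.lean`
(planner K2E1b-plan (g0)), socket **`sig_K2E1bTwistHermitian`** (#8, size M): for every Kovačević datum `𝒟`, every
`e : ℤ` and every central twist `σ` of `𝒟.ρ` by `e∕3` (★ `IsTwistOf 𝒟.ρ (e∕3) σ`:
`σ(X) = kovLie 𝒟.ρ X + (e∕3)·tr(X)·1` on `𝔲(2,1)`), unitarizability of the datum (★ `SU21Datum.IsUnitarizable 𝒟`,
[Kovacevic2021, §4 Thm. 4]: a positive-definite Hermitian form `B` with `B(E_{ij} v, w) = ε_i ε_j B(v, E_{ji} w)`,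
`ε = (1, 1, −1)`) gives an invariant positive-definite Hermitian form for `σ` (★ `HasInvariantHermitianForm σ`):
every `σ(X)`, `X ∈ 𝔲(2,1)`, is `B`-skew.  This is the dictionary «unitary ⇒ skew-Hermitian `𝔤`-action» of
[BorelWallach2000, VI Thm. 4.12 (2)] for the twisted modules `J^±_φ`, `D_φ`, `π²_φ` of [Rogawski1990, §12.3 p. 178],
whose centre acts by the non-trivial character `i·1 ↦ i·e(φ)`.

THE MATHEMATICS.  By the tree's generic W3 transport ★ `hasInvariantHermitianForm_kovLie_of_signSkew`
(`Theorems/F0P3bU21Restriction`) Kovačević's sign-skew form `B` is invariant for the honest restricted action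
`kovLie 𝒟.ρ` (`⁅E_{ij}, v⁆ = 𝒟.ρ(E_{ij}) v` by ★ `SU21Datum.lie_def`).  The twist adds the scalar operator
`c·1`, `c = (e∕3)·tr X`; for `X ∈ 𝔲(2,1)` the trace is purely imaginary (★ `upq_trace_re_eq_zero`,
[BorelWallach2000, II §1.1 (3)]: the diagonal blocks of `X` are skew-Hermitian) and `e∕3` is real, so `conj c = −c`
and `B(c v, w) = conj c · B(v, w) = −B(v, c w)`: the scalar part is `B`-skew too, and skewness is additive.

* §1 `hasInvariantHermitianForm_kovLie_of_isUnitarizable` — W3 for an ARBITRARY datum (the tree's ★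
  `stubW3Hermitian_holds` is the case `𝒟 = ladderPlus`); `conj_twistScalar` — `conj ((e∕3)·tr X) = −(e∕3)·tr X`.
* §2 **`twistHermitian`** — `sig_K2E1bTwistHermitian` TOKEN FOR TOKEN.

HONEST LABEL: HC_CM is proved only modulo the 7 printed citations (2 remaining named inputs: hLiu418 =
stmt-HodgeConjecture-24832, h413 = stmt-HodgeConjecture-24833) until rung 0 closes; this file is a
`--supports stmt-HodgeConjecture-24833 --as helper` file (one socket of the K2_E1b road) and retires nothing by itself.
-/

set_option autoImplicit false
set_option linter.dupNamespace false

noncomputable section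

open scoped ComplexConjugate

namespace Summit.HodgeConjecture.HodgeConjecture.Cruxes.H413.K2E1bTwistHermitian

open Literature.NumberTheory.Automorphic
open Literature.RepresentationTheory.BorelWallach2000
open Literature.RepresentationTheory.KonnoKonno2007 Literature.RepresentationTheory.KonnoKonno2007.RealDualPair
open Literature.RepresentationTheory.KonnoKonno2007.RealDualPair.UForm
open Literature.RepresentationTheory.Kovacevic2021 Literature.RepresentationTheory.Kovacevic2021.SU21Datum
open Summit.HodgeConjecture.HodgeConjecture.Cruxes.H413.F0P3bLocalAPacketsDefs
open Summit.HodgeConjecture.HodgeConjecture.Cruxes.H413.F0P3bU21Restriction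
open Summit.HodgeConjecture.HodgeConjecture.Cruxes.H413.K2E1bGKCohomologyU21

-- Mathlib idiom (Mathlib/Algebra/Lie/OfAssociative.lean, as in `GKModules`, the `Upq*` files, the Kovačević topic, ★ (w3g) and the
-- socket module): commutator bracket on `Module.End` ∕ matrices — needed to even state `G21.lie →ₗ⁅ℝ⁆ Module.End ℂ 𝒟.V` and `𝒟.ρ`.
attribute [local instance 100] LieRing.ofAssociativeRing

/-! ## §1  W3 for an arbitrary Kovačević datum, and the twist scalar is purely imaginary -/

/-- **W3 for every datum.**  A unitarizable Kovačević datum (`B(E_{ij} v, w) = ε_i ε_j B(v, E_{ji} w)`, `ε = (1, 1, −1)`)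
carries an invariant positive-definite Hermitian form for the honest `𝔲(2,1)`-action `kovLie 𝒟.ρ` — Kovačević's
sign-skewness on the matrix units is exactly the hypothesis of ★ `hasInvariantHermitianForm_kovLie_of_signSkew`
(`⁅E_{ij}, v⁆ = 𝒟.ρ(E_{ij}) v`, ★ `lie_def`).  The tree's ★ `stubW3Hermitian_holds` is the case `𝒟 = ladderPlus`.
[cite: Kovacevic2021, §4 Thm. 4] [cite: BorelWallach2000, VI Thm. 4.12 (2)] -/
theorem hasInvariantHermitianForm_kovLie_of_isUnitarizable (𝒟 : SU21Datum) (h𝒟 : IsUnitarizable 𝒟) :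
    HasInvariantHermitianForm (kovLie 𝒟.ρ) := by
  obtain ⟨B, h1, h2, h3⟩ := h𝒟
  refine hasInvariantHermitianForm_kovLie_of_signSkew 𝒟.ρ B h1 h2 fun i j v w => ?_
  have h := h3 i j v w
  simp only [suSign, lie_def] at h
  simpa only [ρ_apply] using h

/-- **The twist scalar is purely imaginary**: for `X ∈ 𝔲(2,1)` and `e : ℤ`, `conj ((e∕3)·tr X) = −(e∕3)·tr X`
(`tr X ∈ iℝ` by ★ `upq_trace_re_eq_zero`: the diagonal blocks of `X` are skew-Hermitian; `e∕3 ∈ ℝ`).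
[cite: BorelWallach2000, II §1.1 (3)] -/
theorem conj_twistScalar (e : ℤ) (X : G21.lie) :
    conj ((e : ℂ) / 3 * (X : Matrix (Fin 2 ⊕ Fin 1) (Fin 2 ⊕ Fin 1) ℂ).trace) =
      -((e : ℂ) / 3 * (X : Matrix (Fin 2 ⊕ Fin 1) (Fin 2 ⊕ Fin 1) ℂ).trace) := by
  have hre : ((X : Matrix (Fin 2 ⊕ Fin 1) (Fin 2 ⊕ Fin 1) ℂ).trace).re = 0 := upq_trace_re_eq_zero X
  have htr : conj ((X : Matrix (Fin 2 ⊕ Fin 1) (Fin 2 ⊕ Fin 1) ℂ).trace) =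
      -(X : Matrix (Fin 2 ⊕ Fin 1) (Fin 2 ⊕ Fin 1) ℂ).trace :=
    Complex.ext (by simp [hre]) (by simp)
  have he : conj ((e : ℂ) / 3) = (e : ℂ) / 3 := by rw [map_div₀, map_intCast, map_ofNat]
  rw [map_mul, htr, he, mul_neg]

/-! ## §2  The head -/

/-- **PAYMENT OF `sig_K2E1bTwistHermitian`** (socket #8 of unit U0 «TwistIntegration» of the K2_E1b road,
`Cruxes/H413/Lines/K2_E1b_GKCohomologyU21_U0_TwistIntegration.lean`, TOKEN FOR TOKEN): UNITARITY SURVIVES THE TWIST —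
Kovačević's positive-definite sign-skew Hermitian form `B` (★ `IsUnitarizable 𝒟`) is invariant for the central twist
`σ = kovLie 𝒟.ρ + (e∕3)·tr(·)·1` of `𝒟.ρ`: `kovLie 𝒟.ρ X` is `B`-skew by §1 (W3), and the twist adds the scalar
`c = (e∕3)·tr X` with `conj c = −c` (§1), so `B(σ(X) v, w) = B(kovLie X v, w) + conj c · B(v, w) =
−B(v, kovLie X w) − c · B(v, w) = −B(v, σ(X) w)`.  With ★ T3a this is the unitarity of the twisted modules
`J^±_φ`, `D_φ`, `π²_φ` along `𝔭 ⊕ ℝz₀` (Borel–Wallach VI Thm. 4.12 (2): the cohomological modules are unitary).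
[cite: Kovacevic2021, §4 Thm. 4] [cite: BorelWallach2000, VI Thm. 4.12 (2)] -/
theorem twistHermitian :
    ∀ (𝒟 : SU21Datum) (e : ℤ) (σ : G21.lie →ₗ⁅ℝ⁆ Module.End ℂ 𝒟.V),
      IsTwistOf 𝒟.ρ ((e : ℂ) / 3) σ → IsUnitarizable 𝒟 → HasInvariantHermitianForm σ := by
  intro 𝒟 e σ hσ h𝒟
  obtain ⟨B, hB, hpos, hskew⟩ := hasInvariantHermitianForm_kovLie_of_isUnitarizable 𝒟 h𝒟
  refine ⟨B, hB, hpos, fun X v w => ?_⟩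
  -- `σ X = kovLie 𝒟.ρ X + c • 1`, `c = (e∕3)·tr X` purely imaginary
  rw [hσ X, LinearMap.add_apply, LinearMap.add_apply, LinearMap.smul_apply, LinearMap.smul_apply,
    Module.End.one_apply, Module.End.one_apply, map_add, LinearMap.add_apply, LinearMap.map_smulₛₗ,
    LinearMap.smul_apply, map_add, map_smul, hskew X v w, conj_twistScalar e X, smul_eq_mul, smul_eq_mul]
  ring

end Summit.HodgeConjecture.HodgeConjecture.Cruxes.H413.K2E1bTwistHermitian

end
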